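import Literature.MathematicalPhysics.QuantumFieldTheory.Balaban1983to89.B9CubeLettersInvWriteDict
import Literature.MathematicalPhysics.QuantumFieldTheory.Balaban1983to89.B9Thm37CubeCoverCommutators
import Literature.MathematicalPhysics.QuantumFieldTheory.Balaban1983to89.B9GeoLemma21KLevelV1
import Literature.MathematicalPhysics.QuantumFieldTheory.Balaban1983to89.B9RWSums347DefiniteFaces

/-!
# `Balaban1983to89.B9Thm37GpTorusRegular` — T. Bałaban, *Propagators for lattice gauge theories in a background field*, Commun. Math. Phys.
# **99** (1985) 389–434 [Balaban1985BackgroundPropagators], Theorem 3.7 (3.87)–(3.90) pp. 409–410 ⇒ the first inequality (3.42) of Theorem 3.1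
# for `G′(U)` AT def-Y's CARRIERS: r06's kernel-checked summation `B9Thm37Sum.thm37_entry1` INSTANTIATED at the real coordinates `SiteY i × ι` of the
# member's `𝔸`-valued site functions, and the result WRITTEN back as the (3.42)₁ line over the gauge-invariant test class (FILE 1: hypotheses displayed)

statement-level skeleton of published theorems with citation tags; proofs where landed; nothing here is a claim about the Yang–Mills mass gap

PDF held: `paper:balaban1985-cmp99-background-propagators` (journal page = PDF page + 388); pp. 397, 403, 409–410 read from the held text layer.

THE PRINT.  p. 409: *«G′₀ = Σ_{□∈𝒟} h_□G′_□h_□ … (3.87) … Δ′_aG′₀ = I − Σ_{□∈𝒟} K(h_□)G′_□h_□ = I − R′. Using the inequalities (3.42) for G′_□, we get the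
bound |(K(h_□)G′_□h_□λ)(x)| ≦ O(M⁻¹)e^{−δ₀(Lʲη)⁻¹|y−y′|}|λ| (3.89) … Theorem 3.7. For M sufficiently large, and a configuration U satisfying (3.35), the
operator G′ can be represented as G′ = G′₀(I − R′)⁻¹ = … (3.90) … The expansion is convergent in all norms appearing in the inequalities (3.42)–(3.47).»*
p. 410: *«This theorem follows simply from Corollary 3.6 holding for all G′_□, □ ∈ 𝒟, from the bound (3.89) and Lemma 2.1. … Theorem 3.7 implies that
all the inequalities (3.42)–(3.47) hold for G′, thus we have completed the proof of Theorem 3.1. … We can get a decay rate arbitrarily close to the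
decay rate of the localized [operators]»*; p. 403: *«of course with different constants»*; p. 397 (3.42)₁: *«|(G′(U)λ)(x)| ≦ B₀(Lʲη)²e^{−δ₀d(y,y′)}|λ|»*.

WHY THIS FILE (cell context: G-B9-LETTERS, module M5.5 FILE 1; statement list v0 page∕name-checked by r06 g63 02:01Z).  `B9Thm37Sum.thm37_entry1`
(r06 lineage) proves the p. 410 argument over ANY real function lattice `X → ℝ` with a block map: localized terms `T_□` with majorants
`1_{S_□}·B₀ℓ²e^{−δ₀d}` (overlap ≤ N), remainders `R_□` with `1_{S′_□}·θe^{−δ₀d}` (overlap ≤ N′), `G′Δ = 1`, `Δ·ΣT_□ = 1 − ΣR_□`, Lemma 2.1 of [4]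
((2.61)∕(2.63)) and `N′θc₁(α) < 1` give `G′` the majorant `N·B₀c₁(α)(1 − N′θc₁(α))⁻¹·ℓ²·e^{−(1−α)δ₀d}`.  THIS FILE instantiates it at def-Y's carriers:
`X := SiteY i × ι` (real coordinates in a basis `b` of `𝔸`), `blk := (z, j) ↦ ιB(Δ(z))` (corner-free member: a section `ιB` of `β`), the letters
realified by `B9Eq352DivFormLetters.conj b` — `G′ := conj b (η²·G′(U))`, `Δ := conj b (η⁻²·Δ′_a(U))`, `T_□ := conj b (η²·T_□)`, `R_□ := conj b R_□` for
ABSTRACT `𝔸`-letters `G′(U), Δ′_a(U), T_□ = h_□G′_□(U)h_□, R_□ = K(h_□)G′_□(U)h_□` (M5.3 ∕ M5.1c ∕ M5.4 construct them) — proving the two algebraic inputs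
from their `𝔸`-level forms (`conj b` is multiplicative and additive: `conj_one`, `conj_sum`, `conj_smul`), and WRITES the resulting majorant back
as the (3.42)₁ line for EVERY test function of the invariant class (`B9CubeLettersInvWriteDict.norm_apply_le_of_hasMajorant_testY`) and as the
`e 0` entry of `kernelFamilySInv` — (3.42)₁ FOR `G′(U)` AT A GENERAL REGULAR `U`, rate `(1−α)δ₀`, constant `M₂(Σ_j‖b_j‖)·N·B₀c₁(α)(1−N′θc₁(α))⁻¹`.
DISPLAYED HYPOTHESES = the named outputs of the sibling modules: `hT` (Cor. 3.6 for every `G′_□`: M5.2's `thms31to33_cube_of_reg335` ∘ M5.1b, read by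
`B9CubeLettersInvReadDict` §4 and localized by `B9Thm37Sum.hasMajorant_sandwich_local`), `h389` (M5.4-est, p38's `B9Thm37CommutatorBound389*`), `hinv`
(M5.3: `G′(U) = Δ′_a(U)⁻¹` on the class (3.35)), `h388` (p38's `B9Thm37CubeCoverCommutators` (3.88) ∕ `B9Thm37Sum.eq388_sum`), the (2.61)∕(2.63)∕(2.54)
faces at `toB6 (geo9K i) Rr Hp` (`B9GeoLemma21KLevelV1.rowSum261_geo9K` → `B9RWSums347DefiniteFaces.ineq261_exp261_of_rowSum261`, exponent `d′` free here,
`B9Thm34Ext.h263_of_h261`).  Nothing of Theorem 3.7's summation or of [4] Lemma 2.1 is re-proved; FILE 2 = entries 2–4 ((3.42)₂₋₄ via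
`B9Thm37Glue.thm37_entry2∕3∕4_of_342_lattice_of_387*`).

WHAT IS PROVED (all `theorem`s, no `sorry`).  §1 `conj_one`, `conj_sum`, `conj_smul`, `conj_scaled_mul_inv`, `conj_scaled_388`; §2 ★★ `hasMajorant_conj_Gp_of_cubes`;
§3 ★★ `sq_eta_norm_Gp_le_of_cubes` ((3.42)₁ pointwise for every `Λ ∈ TestY 𝔸 f`), ★★ `e0_kernelFamilySInv_le_of_cubes`; §4 `conj_cutMulY`,
★ `hasMajorant_conj_cut_sandwich` (the `hT` input from Cor. 3.6 for `G′_□` read by `B9CubeLettersInvReadDict` §4); §5 `geo_inputs_geo9K`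
(the five geometric inputs at the k-level V1 family by name, exponent `exp261 geo9K δ₀ α`).
-/

noncomputable section

namespace Literature.MathematicalPhysics.QuantumFieldTheory.Balaban1983to89.B9Thm37GpTorusRegular

open Node00 B9CubeLettersInvReadings B9CubeLettersInvReadDict B9CubeLettersInvWriteDict
open Node00.OpsYRead342 (norm_le_supBlkS geo9K_len_congr geo9K_dist_congr)
open B6Geom246MultiLevelBox (blkOf)
open B6Ineq2142KLevelV1 (β)
open B6KLevelCensusIndexV1 (KIdx)
open B6Prop22KLevelCensusEta (epow)
open B6RandomWalk (HasMajorant Triangle254 Ineq261 Ineq263 hasMajorant_mono)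
open B9Thm34Ext (toB6)
open B9GeoNormsKLevelV1 (geo9K geo9K_supNorm_nonneg)
open B9Eq352DivFormLetters (coordEquiv conj conj_sub)
open B9Ineq349SiteComposite (supBlkS_le etaS_pos)
open B9Thm37Sum (thm37_entry1 mulOp mulOp_apply hasMajorant_sandwich_local)
open B9Thm37CubeCoverCommutators (cutMulY cutMulY_apply)
open scoped Matrix

variable {d ℓ : ℕ} {hd : 1 ≤ d + 1} {hL : Odd (ℓ + 1) ∧ 1 < ℓ + 1} {b₀ b₁ : ℝ}
variable {𝔸 : Type} [NormedRing 𝔸] [NormedAlgebra ℂ 𝔸] [CompleteSpace 𝔸]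
variable {ι : Type} [Fintype ι]
variable (i : KIdx d ℓ hd hL b₀ b₁) (b : Module.Basis ι ℝ 𝔸)

/-! ## §1 `conj b` is an algebra map: the two algebraic inputs of Theorem 3.7 pass to real coordinates -/

section Conj

variable {S : Type}

omit [CompleteSpace 𝔸] in
/-- `conj b 1 = 1`. [cite: Balaban1984PropagatorsII, (2.52) p.232, bookkeeping] -/
theorem conj_one : conj b (1 : Module.End ℝ (S → 𝔸)) = 1 :=
  LinearEquiv.conj_id _

omit [CompleteSpace 𝔸] in
/-- `conj b` is additive over finite sums ([4] p.232 «A summation preserves it also»). [cite: Balaban1984PropagatorsII, (2.52) p.232, bookkeeping] -/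
theorem conj_sum {κ : Type} (s : Finset κ) (T : κ → Module.End ℝ (S → 𝔸)) : conj b (∑ k ∈ s, T k) = ∑ k ∈ s, conj b (T k) :=
  map_sum ((coordEquiv b).conj : Module.End ℝ (S → 𝔸) ≃ₗ[ℝ] Module.End ℝ (S × ι → ℝ)) T s

omit [CompleteSpace 𝔸] in
/-- `conj b` commutes with real scalars. [cite: Balaban1984PropagatorsII, (2.52) p.232, bookkeeping] -/
theorem conj_smul (r : ℝ) (T : Module.End ℝ (S → 𝔸)) : conj b (r • T) = r • conj b T :=
  map_smul ((coordEquiv b).conj : Module.End ℝ (S → 𝔸) ≃ₗ[ℝ] Module.End ℝ (S × ι → ℝ)) r T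

omit [CompleteSpace 𝔸] in
/-- **`G′Δ′_a = 1` in real coordinates, with the scale weights**: `conj b (η²G′) · conj b (η⁻²Δ′_a) = 1` from `G′·Δ′_a = 1` (`η ≠ 0`).
[cite: Balaban1985BackgroundPropagators, (3.24)–(3.25) p.394 (G′ = (Δ′_a)⁻¹), Thm 3.7 proof p.410] -/
theorem conj_scaled_mul_inv {η : ℝ} (hη : η ≠ 0) {G Δ : Module.End ℝ (S → 𝔸)} (hinv : G * Δ = 1) :
    conj b ((η ^ 2) • G) * conj b ((η ^ 2)⁻¹ • Δ) = 1 := by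
  rw [← B9Eq352DivFormLetters.conj_mul, smul_mul_smul_comm, mul_inv_cancel₀ (pow_ne_zero 2 hη), one_smul, hinv, conj_one]

omit [CompleteSpace 𝔸] in
/-- **(3.88) in real coordinates, with the scale weights**: `conj b (η⁻²Δ′_a) · Σ_□ conj b (η²T_□) = 1 − Σ_□ conj b R_□` from `Δ′_a·Σ_□T_□ = 1 − Σ_□R_□`.
[cite: Balaban1985BackgroundPropagators, (3.88) p.409 («Δ′_aG′₀ = I − Σ K(h_□)G′_□h_□ = I − R′»)] -/
theorem conj_scaled_388 {η : ℝ} (hη : η ≠ 0) {κ : Type} [Fintype κ] {Δ : Module.End ℝ (S → 𝔸)} {T R : κ → Module.End ℝ (S → 𝔸)}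
    (h388 : Δ * (∑ k, T k) = 1 - ∑ k, R k) :
    conj b ((η ^ 2)⁻¹ • Δ) * (∑ k, conj b ((η ^ 2) • T k)) = 1 - ∑ k, conj b (R k) := by
  have hs : (∑ k, conj b ((η ^ 2) • T k)) = conj b ((η ^ 2) • ∑ k, T k) := by
    rw [Finset.smul_sum, conj_sum]
  rw [hs, ← B9Eq352DivFormLetters.conj_mul, smul_mul_smul_comm, inv_mul_cancel₀ (pow_ne_zero 2 hη), one_smul, h388, conj_sub, conj_one, conj_sum]

end Conj

/-! ## §2 Theorem 3.7 ⇒ (3.42)₁ for `G′(U)` at def-Y's carriers: the majorant of `conj b (η²G′(U))` from the cube data -/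

section Cubes

variable [DecidableEq ι] [Fintype (geo9K i).Site] [DecidableEq (geo9K i).Site] {Rr : ℝ} {Hp : Prop}
variable (ιB : BlkY i → IBondY i)

omit [CompleteSpace 𝔸] in
/-- ★★ **THEOREM 3.7 ⇒ THE FIRST (3.42) MAJORANT FOR `G′(U)`, AT def-Y's CARRIERS** (p. 410 «follows simply from Corollary 3.6 holding for all G′_□,
□ ∈ 𝒟, from the bound (3.89) and Lemma 2.1»): for `𝔸`-letters `G′(U), Δ′_a(U)` with `G′Δ′_a = 1` (`hinv`), cube terms `T_□` (= `h_□G′_□h_□`) and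
`R_□` (= `K(h_□)G′_□h_□`) with `Δ′_a·Σ_□T_□ = 1 − Σ_□R_□` ((3.88), `h388`), localized block majorants of `conj b (η²T_□)` (Cor. 3.6 for `G′_□`, `hT`,
overlap ≤ N) and of `conj b R_□` ((3.89), `h389`, overlap ≤ N′), [4] Lemma 2.1 at exponent `α` for the member's geometry (`h261`, `h263`, `htri`) and
the smallness `N′θc₁(α) < 1` («M sufficiently large»): `conj b (η²G′(U))` has the majorant `N·B₀c₁(α)(1 − N′θc₁(α))⁻¹·ℓ(a)²·e^{−(1−α)δ₀d(a,a′)}`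
— `B9Thm37Sum.thm37_entry1` at `X := SiteY i × ι`, `blk := (z, j) ↦ ιB(Δ(z))`. [cite: Balaban1985BackgroundPropagators, Thm 3.7 (3.87)–(3.90) p.409 + proof p.410] -/
theorem hasMajorant_conj_Gp_of_cubes (d' : ℕ) {δ₀ α θ B₀ N N' : ℝ} {κ : Type} [Fintype κ]
    (S S' : κ → Finset (geo9K i).Site) {G Δ : Module.End ℝ (SiteY i → 𝔸)} (T R : κ → Module.End ℝ (SiteY i → 𝔸))
    {η : ℝ} (hη : η ≠ 0) (hB₀ : 0 ≤ B₀) (hθ : 0 ≤ θ) (hN : 0 ≤ N) (hN' : 0 ≤ N') (hαδ : 0 ≤ (1 - α) * δ₀)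
    (htri : Triangle254 (toB6 (geo9K i) Rr Hp)) (hrefl : ∀ y : (geo9K i).Site, (geo9K i).dist y y = 0)
    (hdnn : ∀ y y' : (geo9K i).Site, 0 ≤ (geo9K i).dist y y')
    (h261 : Ineq261 d' (toB6 (geo9K i) Rr Hp) δ₀ α) (h263 : Ineq263 d' (toB6 (geo9K i) Rr Hp) δ₀ α)
    (hsmall : N' * θ * B6.c1 d' δ₀ α < 1)
    (hT : ∀ k, HasMajorant (g := toB6 (geo9K i) Rr Hp) (fun p : SiteY i × ι => ιB (blkOf i.D.toDomains p.1)) (conj b ((η ^ 2) • T k))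
      (fun a a' => if a ∈ S k then B₀ * (geo9K i).len a ^ 2 * Real.exp (-(δ₀ * (geo9K i).dist a a')) else 0))
    (hcnt : ∀ a : (geo9K i).Site, (∑ k, if a ∈ S k then (1 : ℝ) else 0) ≤ N)
    (h389 : ∀ k, HasMajorant (g := toB6 (geo9K i) Rr Hp) (fun p : SiteY i × ι => ιB (blkOf i.D.toDomains p.1)) (conj b (R k))
      (fun a a' => if a ∈ S' k then θ * Real.exp (-(δ₀ * (geo9K i).dist a a')) else 0))
    (hcnt' : ∀ a : (geo9K i).Site, (∑ k, if a ∈ S' k then (1 : ℝ) else 0) ≤ N')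
    (hinv : G * Δ = 1) (h388 : Δ * (∑ k, T k) = 1 - ∑ k, R k) :
    HasMajorant (g := toB6 (geo9K i) Rr Hp) (fun p : SiteY i × ι => ιB (blkOf i.D.toDomains p.1)) (conj b ((η ^ 2) • G))
      (fun a a' => N * B₀ * B6.c1 d' δ₀ α * (1 - N' * θ * B6.c1 d' δ₀ α)⁻¹ * (geo9K i).len a ^ 2 *
        Real.exp (-((1 - α) * δ₀ * (geo9K i).dist a a'))) :=
  thm37_entry1 (fun p : SiteY i × ι => ιB (blkOf i.D.toDomains p.1)) d' δ₀ α θ B₀ N N' S S'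
    (fun k => conj b ((η ^ 2) • T k)) (fun k => conj b (R k)) hB₀ hθ hN hN' hαδ htri hrefl hdnn h261 h263 hsmall hT hcnt h389 hcnt'
    (conj_scaled_mul_inv b hη hinv) (conj_scaled_388 b hη h388)

/-! ## §3 The majorant WRITTEN back: (3.42)₁ for `G′(U)` for every test function of the class, and the `e 0` entry of `kernelFamilySInv` -/

variable {B : B9.Backgrounds} (cfg : B.Cfg → CfgY 𝔸 i) (O : SiteOpY 𝔸 i) (par : SiteParY 𝔸 i) {U₁ : B.Cfg}

omit [CompleteSpace 𝔸] in
/-- ★★ **(3.42)₁ FOR `G′(U)` AT A GENERAL CONFIGURATION, POINTWISE OVER THE CLASS**: under the hypotheses of `hasMajorant_conj_Gp_of_cubes` for an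
ℝ-linear letter `G` (= `G′(U)` restricted to real scalars), every `Λ ∈ TestY 𝔸 f` with `supp f ⊂ Δ(βy′)` has
`η²‖(GΛ)(z)‖ ≤ (Σ_j‖b_j‖)·C·ℓ(y)²·e^{−(1−α)δ₀d(y,y′)}·M₂|f|` for `z ∈ Δ(βy)`, `C = N·B₀c₁(α)(1 − N′θc₁(α))⁻¹` (p. 410 «decay rate arbitrarily close»;
p. 403 «of course with different constants»). [cite: Balaban1985BackgroundPropagators, Thm 3.1 (3.42)₁ p.397 via Thm 3.7 pp.409–410] -/
theorem sq_eta_norm_Gp_le_of_cubes (hι : ∀ s, β i.hN i.D i.hk (ιB s) = s)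
    {M₂ : ℝ} (hM₂ : 0 ≤ M₂) (hrepr : ∀ (v : 𝔸) (j : ι), |b.repr v j| ≤ M₂ * ‖v‖)
    (d' : ℕ) {δ₀ α θ B₀ N N' : ℝ} {κ : Type} [Fintype κ]
    (S S' : κ → Finset (geo9K i).Site) {G Δ : Module.End ℝ (SiteY i → 𝔸)} (T R : κ → Module.End ℝ (SiteY i → 𝔸))
    (hB₀ : 0 ≤ B₀) (hθ : 0 ≤ θ) (hN : 0 ≤ N) (hN' : 0 ≤ N') (hαδ : 0 ≤ (1 - α) * δ₀)
    (htri : Triangle254 (toB6 (geo9K i) Rr Hp)) (hrefl : ∀ y : (geo9K i).Site, (geo9K i).dist y y = 0)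
    (hdnn : ∀ y y' : (geo9K i).Site, 0 ≤ (geo9K i).dist y y')
    (h261 : Ineq261 d' (toB6 (geo9K i) Rr Hp) δ₀ α) (h263 : Ineq263 d' (toB6 (geo9K i) Rr Hp) δ₀ α)
    (hsmall : N' * θ * B6.c1 d' δ₀ α < 1)
    (hT : ∀ k, HasMajorant (g := toB6 (geo9K i) Rr Hp) (fun p : SiteY i × ι => ιB (blkOf i.D.toDomains p.1))
      (conj b ((etaS i ^ 2) • T k))
      (fun a a' => if a ∈ S k then B₀ * (geo9K i).len a ^ 2 * Real.exp (-(δ₀ * (geo9K i).dist a a')) else 0))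
    (hcnt : ∀ a : (geo9K i).Site, (∑ k, if a ∈ S k then (1 : ℝ) else 0) ≤ N)
    (h389 : ∀ k, HasMajorant (g := toB6 (geo9K i) Rr Hp) (fun p : SiteY i × ι => ιB (blkOf i.D.toDomains p.1)) (conj b (R k))
      (fun a a' => if a ∈ S' k then θ * Real.exp (-(δ₀ * (geo9K i).dist a a')) else 0))
    (hcnt' : ∀ a : (geo9K i).Site, (∑ k, if a ∈ S' k then (1 : ℝ) else 0) ≤ N')
    (hinv : G * Δ = 1) (h388 : Δ * (∑ k, T k) = 1 - ∑ k, R k)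
    (f : SiteY i → ℝ) (y y' : IBondY i) (hs : (geo9K i).suppIn (Sum.inl f) y') (Λ : TestY 𝔸 f)
    {z : SiteY i} (hz : blkOf i.D.toDomains z = β i.hN i.D i.hk y) :
    etaS i ^ 2 * ‖G Λ.1 z‖ ≤ (∑ j, ‖b j‖) * (N * B₀ * B6.c1 d' δ₀ α * (1 - N' * θ * B6.c1 d' δ₀ α)⁻¹ * (geo9K i).len y ^ 2 *
      Real.exp (-((1 - α) * δ₀ * (geo9K i).dist y y'))) * (M₂ * (geo9K i).supNorm (Sum.inl f)) := by
  have hmaj := hasMajorant_conj_Gp_of_cubes i b ιB d' S S' T R (etaS_pos i).ne' hB₀ hθ hN hN' hαδ htri hrefl hdnn h261 h263 hsmall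
    hT hcnt h389 hcnt' hinv h388
  have hw := norm_apply_le_of_hasMajorant_testY i b (Rr := Rr) (Hp := Hp) ((etaS i ^ 2) • G) ιB hM₂ hrepr hmaj f y' hs Λ z
  rw [LinearMap.smul_apply, Pi.smul_apply, norm_smul, Real.norm_eq_abs, abs_of_nonneg (sq_nonneg _),
    geo9K_len_congr i (show β i.hN i.D i.hk (ιB (blkOf i.D.toDomains z)) = β i.hN i.D i.hk y by rw [hι]; exact hz),
    geo9K_dist_congr i (show β i.hN i.D i.hk (ιB (blkOf i.D.toDomains z)) = β i.hN i.D i.hk y by rw [hι]; exact hz) (hι _)] at hw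
  exact hw.trans (le_of_eq (by ring))

/-- ★★ **THE `e 0` ENTRY OF THE READING OVER THE CLASS AT `U`** from the cube data: the (3.42)₁ clause of `B9FromB6.EBlock (kernelFamilySInv …)` at `U₁`
with constant `M₂(Σ_j‖b_j‖)·N·B₀c₁(α)(1 − N′θc₁(α))⁻¹` and rate `(1−α)δ₀`. [cite: Balaban1985BackgroundPropagators, Thm 3.1 (3.42)₁ p.397 via Thm 3.7 pp.409–410] -/
theorem e0_kernelFamilySInv_le_of_cubes (hι : ∀ s, β i.hN i.D i.hk (ιB s) = s)
    {M₂ : ℝ} (hM₂ : 0 ≤ M₂) (hrepr : ∀ (v : 𝔸) (j : ι), |b.repr v j| ≤ M₂ * ‖v‖)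
    (d' : ℕ) {δ₀ α θ B₀ N N' : ℝ} {κ : Type} [Fintype κ]
    (S S' : κ → Finset (geo9K i).Site) {Δ : Module.End ℝ (SiteY i → 𝔸)} (T R : κ → Module.End ℝ (SiteY i → 𝔸))
    (hB₀ : 0 ≤ B₀) (hθ : 0 ≤ θ) (hN : 0 ≤ N) (hN' : 0 ≤ N') (hαδ : 0 ≤ (1 - α) * δ₀)
    (htri : Triangle254 (toB6 (geo9K i) Rr Hp)) (hrefl : ∀ y : (geo9K i).Site, (geo9K i).dist y y = 0)
    (hdnn : ∀ y y' : (geo9K i).Site, 0 ≤ (geo9K i).dist y y')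
    (h261 : Ineq261 d' (toB6 (geo9K i) Rr Hp) δ₀ α) (h263 : Ineq263 d' (toB6 (geo9K i) Rr Hp) δ₀ α)
    (hsmall : N' * θ * B6.c1 d' δ₀ α < 1)
    (hT : ∀ k, HasMajorant (g := toB6 (geo9K i) Rr Hp) (fun p : SiteY i × ι => ιB (blkOf i.D.toDomains p.1))
      (conj b ((etaS i ^ 2) • T k))
      (fun a a' => if a ∈ S k then B₀ * (geo9K i).len a ^ 2 * Real.exp (-(δ₀ * (geo9K i).dist a a')) else 0))
    (hcnt : ∀ a : (geo9K i).Site, (∑ k, if a ∈ S k then (1 : ℝ) else 0) ≤ N)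
    (h389 : ∀ k, HasMajorant (g := toB6 (geo9K i) Rr Hp) (fun p : SiteY i × ι => ιB (blkOf i.D.toDomains p.1)) (conj b (R k))
      (fun a a' => if a ∈ S' k then θ * Real.exp (-(δ₀ * (geo9K i).dist a a')) else 0))
    (hcnt' : ∀ a : (geo9K i).Site, (∑ k, if a ∈ S' k then (1 : ℝ) else 0) ≤ N')
    (hinv : (O (cfg U₁)).restrictScalars ℝ * Δ = 1) (h388 : Δ * (∑ k, T k) = 1 - ∑ k, R k)
    (f : SiteY i → ℝ) (y y' : IBondY i) (hs : (geo9K i).suppIn (Sum.inl f) y') :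
    (kernelFamilySInv i B cfg O par).e 0 U₁ (Sum.inl f) y ≤
      M₂ * (∑ j, ‖b j‖) * (N * B₀ * B6.c1 d' δ₀ α * (1 - N' * θ * B6.c1 d' δ₀ α)⁻¹) * (geo9K i).len y ^ 2 *
        Real.exp (-((1 - α) * δ₀ * (geo9K i).dist y y')) * (geo9K i).supNorm (Sum.inl f) := by
  have hSb : 0 ≤ ∑ j, ‖b j‖ := Finset.sum_nonneg fun _ _ => norm_nonneg _
  have hC : 0 ≤ N * B₀ * B6.c1 d' δ₀ α * (1 - N' * θ * B6.c1 d' δ₀ α)⁻¹ :=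
    mul_nonneg (mul_nonneg (mul_nonneg hN hB₀) (B6RandomWalk.c1_nonneg d' δ₀ α)) (inv_nonneg.2 (sub_nonneg.2 hsmall.le))
  have hRHS : 0 ≤ M₂ * (∑ j, ‖b j‖) * (N * B₀ * B6.c1 d' δ₀ α * (1 - N' * θ * B6.c1 d' δ₀ α)⁻¹) * (geo9K i).len y ^ 2 *
      Real.exp (-((1 - α) * δ₀ * (geo9K i).dist y y')) * (geo9K i).supNorm (Sum.inl f) :=
    mul_nonneg (mul_nonneg (mul_nonneg (mul_nonneg (mul_nonneg hM₂ hSb) hC) (sq_nonneg _)) (Real.exp_pos _).le) (geo9K_supNorm_nonneg i _)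
  show etaS i ^ (epow 0) * (⨆ Λ : TestY 𝔸 f, eLatS i O (cfg U₁) Λ.1 (β i.hN i.D i.hk y) 0) ≤ _
  have h0e : epow 0 = 2 := rfl
  have hη : 0 < etaS i ^ 2 := pow_pos (etaS_pos i) 2
  rw [h0e, mul_comm, ← le_div_iff₀ hη]
  refine iSup_testY_le (fun Λ => ?_) (div_nonneg hRHS hη.le)
  show supBlkS i (β i.hN i.D i.hk y) (O (cfg U₁) Λ.1) ≤ _
  refine supBlkS_le i _ _ (div_nonneg hRHS hη.le) fun z hz => ?_
  rw [le_div_iff₀ hη, mul_comm]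
  exact (sq_eta_norm_Gp_le_of_cubes i b ιB hι hM₂ hrepr d' S S' T R hB₀ hθ hN hN' hαδ htri hrefl hdnn h261 h263 hsmall hT hcnt
    h389 hcnt' hinv h388 f y y' hs Λ hz).trans (le_of_eq (by ring))

/-! ## §4 Manufacturing `hT`: the cut-off `h_□` in real coordinates is a multiplication operator; the localized majorant of `h_□G′_□h_□` -/

omit [CompleteSpace 𝔸] [DecidableEq ι] [Fintype (geo9K i).Site] [DecidableEq (geo9K i).Site] in
/-- **`conj b (h·) = mulOp (h ∘ fst)`**: in real coordinates the cut-off multiplication by a real profile `h` (p38's `cutMulY`, the `h_□` of (3.87)) is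
r06's multiplication operator `B9Thm37Sum.mulOp`. [cite: Balaban1985BackgroundPropagators, (3.87) p.409, dictionary] -/
theorem conj_cutMulY (h : SiteY i → ℝ) :
    conj b ((cutMulY (𝔸 := 𝔸) h).restrictScalars ℝ) = mulOp (fun p : SiteY i × ι => h p.1) := by
  apply LinearMap.ext
  intro μ
  funext p
  rw [B9Eq352DivFormLetters.conj_apply, mulOp_apply, LinearMap.restrictScalars_apply, cutMulY_apply, Complex.coe_smul, map_smul,
    Finsupp.smul_apply, smul_eq_mul, ← B9Eq352DivFormLetters.coordEquiv_apply, LinearEquiv.apply_symm_apply]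

omit [CompleteSpace 𝔸] [DecidableEq ι] in
/-- ★ **THE `hT` INPUT OF THEOREM 3.7 FROM COROLLARY 3.6 FOR `G′_□`**: a block majorant `K` of `conj b (η²O_□(U))` (`B9CubeLettersInvReadDict.hasMajorant_conj_G_of_eBlockInv`
from the cube letter's (3.42) block over the class), a cut-off `|h_□| ≤ 1` whose support meets only the blocks of `S_□`, give `conj b (η²·h_□O_□(U)h_□)`
the LOCALIZED majorant `1_{S_□}·K` (`B9Thm37Sum.hasMajorant_sandwich_local`). [cite: Balaban1985BackgroundPropagators, (3.87) p.409 («G′₀ = Σ h_□G′_□h_□»), Cor. 3.6 p.408] -/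
theorem hasMajorant_conj_cut_sandwich {O : Module.End ℝ (SiteY i → 𝔸)} {K : (geo9K i).Site → (geo9K i).Site → ℝ} {η : ℝ}
    (hO : HasMajorant (g := toB6 (geo9K i) Rr Hp) (fun p : SiteY i × ι => ιB (blkOf i.D.toDomains p.1)) (conj b ((η ^ 2) • O)) K)
    (h : SiteY i → ℝ) (hh : ∀ z, |h z| ≤ 1) (S : Finset (geo9K i).Site) (hS : ∀ z, h z ≠ 0 → ιB (blkOf i.D.toDomains z) ∈ S) :
    HasMajorant (g := toB6 (geo9K i) Rr Hp) (fun p : SiteY i × ι => ιB (blkOf i.D.toDomains p.1))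
      (conj b ((η ^ 2) • ((cutMulY (𝔸 := 𝔸) h).restrictScalars ℝ * O * (cutMulY (𝔸 := 𝔸) h).restrictScalars ℝ)))
      (fun a a' => if a ∈ S then K a a' else 0) := by
  have he : (η ^ 2) • ((cutMulY (𝔸 := 𝔸) h).restrictScalars ℝ * O * (cutMulY (𝔸 := 𝔸) h).restrictScalars ℝ) =
      (cutMulY (𝔸 := 𝔸) h).restrictScalars ℝ * ((η ^ 2) • O) * (cutMulY (𝔸 := 𝔸) h).restrictScalars ℝ := by
    rw [mul_smul_comm, smul_mul_assoc]
  rw [he, B9Eq352DivFormLetters.conj_mul, B9Eq352DivFormLetters.conj_mul, conj_cutMulY]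
  exact hasMajorant_sandwich_local (fun p : SiteY i × ι => ιB (blkOf i.D.toDomains p.1)) hO (fun p : SiteY i × ι => h p.1)
    (fun p => hh p.1) S (fun p hp => hS p.1 hp)

end Cubes

/-! ## §5 The geometric inputs at the k-level V1 family, by name: (2.54), `d(y,y) = 0`, `d ≥ 0`, (2.61) at the door exponent, (2.63) -/

section Geo

/-- **[4] LEMMA 2.1 AND THE METRIC AXIOMS FOR THE MEMBER'S GEOMETRY, PACKAGED** for `hasMajorant_conj_Gp_of_cubes`: above ONE threshold `ML ≤ M`,
every member `i` of the k-level V1 family has the triangle inequality (2.54), `d(y,y) = 0`, `d ≥ 0`, and (2.61)∕(2.63) at rate `(δ₀, α)` with the family's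
door exponent `d′ = exp261 geo9K δ₀ α` (r06 lineage: `B9GeoLemma21KLevelV1.rowSum261_geo9K`, `B9RWSums347DefiniteFaces.ineq261_exp261_of_rowSum261`,
`B9Thm34Ext.h263_of_h261`; the transport data `Rr`, `Hp` are free). [cite: Balaban1984PropagatorsII, Lemma 2.1 (2.60)–(2.63) p.234, (2.54) p.232] -/
theorem geo_inputs_geo9K [∀ i' : KIdx d ℓ hd hL b₀ b₁, Fintype (geo9K i').Site] (Rr : KIdx d ℓ hd hL b₀ b₁ → ℝ) (Hp : KIdx d ℓ hd hL b₀ b₁ → Prop)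
    {δ₀ α : ℝ} (hκ : 0 < α * δ₀) (hδ : 0 ≤ δ₀) (hα : α ≤ 1) :
    ∃ ML : ℝ, ∀ i' : KIdx d ℓ hd hL b₀ b₁, ML ≤ (geo9K i').M →
      Triangle254 (toB6 (geo9K i') (Rr i') (Hp i')) ∧ (∀ y : (geo9K i').Site, (geo9K i').dist y y = 0) ∧
      (∀ y y' : (geo9K i').Site, 0 ≤ (geo9K i').dist y y') ∧
      Ineq261 (B9RWSums347DefiniteFaces.exp261 (geo9K (d := d) (ℓ := ℓ) (hd := hd) (hL := hL) (b₀ := b₀) (b₁ := b₁)) δ₀ α)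
        (toB6 (geo9K i') (Rr i') (Hp i')) δ₀ α ∧
      Ineq263 (B9RWSums347DefiniteFaces.exp261 (geo9K (d := d) (ℓ := ℓ) (hd := hd) (hL := hL) (b₀ := b₀) (b₁ := b₁)) δ₀ α)
        (toB6 (geo9K i') (Rr i') (Hp i')) δ₀ α := by
  obtain ⟨ML, h⟩ := B9RWSums347DefiniteFaces.ineq261_exp261_of_rowSum261
    (geo := geo9K (d := d) (ℓ := ℓ) (hd := hd) (hL := hL) (b₀ := b₀) (b₁ := b₁)) Rr Hp hκ
    (B9GeoLemma21KLevelV1.rowSum261_geo9K (d := d) (ℓ := ℓ) (hd := hd) (hL := hL) (b₀ := b₀) (b₁ := b₁))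
  refine ⟨ML, fun i' hM => ?_⟩
  have htri : Triangle254 (toB6 (geo9K i') (Rr i') (Hp i')) :=
    (B9Thm34Ext.triangle254_toB6_iff (geo9K i') (Rr i') (Hp i')).2 (B9GeoLemma21KLevelV1.geo9K_dist_triangle i')
  exact ⟨htri, B9GeoLemma21KLevelV1.geo9K_dist_self i', B9GeoLemma21KLevelV1.geo9K_dist_nonneg' i', h i' hM,
    B9Thm34Ext.h263_of_h261 (geo9K i') (Rr i') (Hp i') _ δ₀ α htri hδ hα (h i' hM)⟩

end Geo

end Literature.MathematicalPhysics.QuantumFieldTheory.Balaban1983to89.B9Thm37GpTorusRegular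

end
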